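import Summits.AnomalousDissipation.AnomalousDissipation.Theorems.BaireTransferRobustLoudUpgradeLine
import Literature.Analysis.FluidPDE.SteadyNSLatticePersistenceDrift

/-!
# Stub `stub_persistSmoothForce` of the line `malkin-cone-group-orbits` (crux stmt-AnomalousDissipation-1144, lead c14,
# cycle 2): leaf persistence of nondegenerate steady states under `L²`-small SMOOTH force perturbations

A classical steady state `u₀` (any mean) of `NS_ν(f)`, `ν > 0`, `f` smooth (NOT assumed divergence free or mean
zero: its gradient part rides with the pressure), whose linearisation has no classical kernel in the mean-zero
class (`¬ Torus.IsLinNSEigenvalue ν u₀ 0`) persists, with the same mean and `H¹`-close, as a classical steady state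
of `NS_ν(g)` for every smooth divergence-free mean-zero `g` with `∫‖g − f‖² < r` — the steady implicit-function
theorem at fixed viscosity in a conserved-mean leaf (Temam 1979 Ch. II §1, Thm. 1.3; Foias–Temam 1977 §1;
Saut–Temam 1980 §2), with no force family.

Proof: the Literature assembly `SteadyLatticeDrift.steadyPersistsInLeaf_of_nondeg` run with the coefficient
family `𝓕(complexify ∘ g) ∈ W` of the admissible force `g` in place of the force map `c' ↦ 𝓕 f_{c'}`; the base
target is the Leray-projected family `(Π_k f̂(k))_k ∈ W` (`fourier_eq_of_isSteadyNSState'`), and Parseval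
(`tsum_enorm_sq_mFourierCoeff_euclidean`) with `‖Π_k v‖ ≤ ‖v‖` turns the `W`-radius of the local inversion into
the `L²`-radius `r²`.  Pure proof file (no definitions).
-/

-- `Summit.<Summit>.<Problem>` is the tree's mandated summit-side namespace (CONVENTIONS §2); for this
-- single-conjunct summit the two coincide, so the duplicate is deliberate.
set_option linter.dupNamespace false

noncomputable section

open scoped BigOperators Topology ENNReal NNReal InnerProductSpace ComplexConjugate
open Filter Set Function TopologicalSpace MeasureTheory UnitAddTorus

namespace Summit.AnomalousDissipation.AnomalousDissipation.Theorems.RobustLoudUpgrade.Poly.PersistSmoothForce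

open Literature.Analysis.FunctionSpaces Literature.Analysis.FunctionSpaces.Torus
open Literature.Analysis.FunctionSpaces.EuclideanSpace
open Literature.Analysis.FluidPDE Literature.Analysis.FluidPDE.ScalarFourier
open Literature.Analysis.FluidPDE.SteadyLattice Literature.Analysis.FluidPDE.SteadyLatticeDrift
open Summit.AnomalousDissipation.AnomalousDissipation.Theses.BaireTransfer
open Summit.AnomalousDissipation.AnomalousDissipation.Theorems.RobustLoudUpgrade

set_option maxHeartbeats 1600000 in
/-- **The registered stub `stub_persistSmoothForce`** (steady implicit-function theorem at fixed viscosity in a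
conserved-mean leaf, for ARBITRARY smooth admissible forces, `L²`-small perturbations): base point
`x₀ = (|k|² û₀(k))_{k≠0} ∈ W`, drifted steady map `G(x) = 4π²ν x + D_m x + B(x,x)` with `G x₀ = (Π_k f̂(k))_k`;
`DG(x₀) = 4π²ν + (D_m + K)` with `D_m + K` compact and injective (a kernel vector is a classical eigenvector,
excluded); Fredholm + inverse function theorem give a `W`-radius `r` around `G x₀`; for admissible `g` the target
`ĝ ∈ W` satisfies `‖ĝ − Π f̂‖_W ≤ ‖g − f‖_{L²}` (Parseval), so `∫‖g − f‖² < r²` suffices; the solution is rapidly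
decaying and synthesises a classical steady state of `NS_ν(g)` of mean `⨍ u₀`, `H¹`-close by Parseval. [folklore] -/
theorem stub_persistSmoothForce :
    ∀ (ν : ℝ) (f u₀ : UnitAddTorus (Fin 3) → EuclideanSpace ℝ (Fin 3)) (p₀ : UnitAddTorus (Fin 3) → ℝ) (δ : ℝ),
      0 < ν → IsSmooth f → Torus.IsSteadyNSState ν f u₀ p₀ → ¬ Torus.IsLinNSEigenvalue ν u₀ 0 → 0 < δ →
      ∃ r : ℝ, 0 < r ∧ ∀ g : UnitAddTorus (Fin 3) → EuclideanSpace ℝ (Fin 3), IsSmooth g → IsDivFree g → HasZeroMean g →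
        (∫ x, ‖g x - f x‖ ^ 2) < r →
        ∃ (u' : UnitAddTorus (Fin 3) → EuclideanSpace ℝ (Fin 3)) (p' : UnitAddTorus (Fin 3) → ℝ),
          Torus.IsSteadyNSState ν g u' p' ∧ (∫ x, u' x) = (∫ x, u₀ x) ∧ h1DistSq u' u₀ < δ := by
  intro ν f u₀ p₀ δ hν hf hst hnd hδ
  -- §1 the unperturbed state on the Fourier side (full family, zero mode = the mean); the base target `Π f̂`
  have hu₀ : IsSmooth u₀ := hst.smooth_velocity.isSmooth_slice (Set.mem_univ 0)
  have hdiv₀ : IsDivFree u₀ := hst.divFree 0 (Set.mem_univ 0)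
  set a : (Fin 3 → ℤ) → (EuclideanSpace ℂ (Fin 3)) := mFourierCoeff (complexify ∘ u₀) with ha
  have har : RapidDecay a := hu₀.complexify_comp.rapidDecay_mFourierCoeff
  have hat : ∀ m : (Fin 3 → ℤ), (∑ jj : Fin 3, ((m jj : ℤ) : ℂ) * (a m) jj) = 0 :=
      fun m => hdiv₀.sum_mul_mFourierCoeff_eq_zero hu₀ m
  have hacs : IsConjSymm a := isConjSymm_mFourierCoeff hu₀.integrable
  have hM : conjVec (a 0) = a 0 := by
    have h := hacs 0
    rw [neg_zero] at h
    exact h.symm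
  have hbr : RapidDecay (Function.update a 0 0) := rapidDecay_update har
  have heq₀ : ∀ k : (Fin 3 → ℤ), (((ν * (4 * Real.pi ^ 2 * freqNormSq k)) : ℝ) : ℂ) • a k + Torus.lerayCoeff k
      ((WithLp.toLp 2 (fun pp : Fin 3 => transportSym (fun jj mm => a mm jj) (fun mm => a mm pp) k) : EuclideanSpace ℂ
      (Fin 3))) = Torus.lerayCoeff k (mFourierCoeff (complexify ∘ f) k) := fun k => by
    rw [ha]
    exact fourier_eq_of_isSteadyNSState' hst hf k
  set F₀ : (Fin 3 → ℤ) → (EuclideanSpace ℂ (Fin 3)) := fun k => Torus.lerayCoeff k (mFourierCoeff (complexify ∘ f) k)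
    with hF₀
  have hF₀r : RapidDecay F₀ := by
    refine hf.complexify_comp.rapidDecay_mFourierCoeff.of_norm_le_mul_pow (C := 1) (s := 0) fun k => ?_
    rw [hF₀, pow_zero, mul_one, one_mul]
    exact norm_lerayCoeff_le k _
  have hfcs : IsConjSymm (mFourierCoeff (complexify ∘ f)) := isConjSymm_mFourierCoeff hf.integrable
  have hF₀V : ((F₀ : (Fin 3 → ℤ) → EuclideanSpace ℂ (Fin 3)) 0 = 0 ∧ (∀ kk : Fin 3 → ℤ, (∑ jj : Fin 3, ((kk jj : ℤ) :
      ℂ) * ((F₀ : (Fin 3 → ℤ) → EuclideanSpace ℂ (Fin 3)) kk) jj) = 0) ∧ IsConjSymm (F₀ : (Fin 3 → ℤ) → EuclideanSpace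
      ℂ (Fin 3))) := by
    refine ⟨by rw [hF₀]; exact Torus.lerayCoeff_zero _, fun k => by rw [hF₀]; exact kdot_lerayCoeff k _, fun k => ?_⟩
    rw [hF₀]
    dsimp only
    rw [hfcs k]
    exact lerayCoeff_neg_conjVec k _
  -- §2 the state space, the bilinear map, the drift, the base target `y₀ = Π f̂ ∈ W`
  obtain ⟨W, hW, hWc⟩ := exists_space
  haveI : CompleteSpace W := completeSpace_W hWc
  obtain ⟨B, hB, hBb⟩ := exists_bilinear hW
  obtain ⟨D, hD, hDc⟩ := exists_drift hW hWc hM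
  set y₀ : W := ⟨⟨F₀, memℓp_two_of_rapidDecay hF₀r⟩, (hW _).2 hF₀V⟩ with hy₀def
  have hy₀ : ((y₀ : (lp (fun _ : Fin 3 → ℤ => EuclideanSpace ℂ (Fin 3)) 2)) : (Fin 3 → ℤ) → (EuclideanSpace ℂ (Fin
      3))) = F₀ := rfl
  -- §3 the base point `x₀` (its physical coefficients are the punctured family `a°`)
  set X₀ : (Fin 3 → ℤ) → (EuclideanSpace ℂ (Fin 3)) := fun k => ((freqNormSq k : ℝ) : ℂ) • a k with hX₀
  have hX₀r : RapidDecay X₀ := by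
    refine har.of_norm_le_mul_pow (C := 1) (s := 1) fun k => ?_
    rw [hX₀]
    dsimp only
    rw [norm_smul, Complex.norm_real, Real.norm_of_nonneg (freqNormSq_nonneg k), one_mul, pow_one]
    exact mul_le_mul_of_nonneg_right (by linarith [freqNormSq_nonneg k]) (norm_nonneg _)
  have hX00 : X₀ 0 = 0 := by simp [hX₀, freqNormSq_zero]
  have hX₀V : ((X₀ : (Fin 3 → ℤ) → EuclideanSpace ℂ (Fin 3)) 0 = 0 ∧ (∀ kk : Fin 3 → ℤ, (∑ jj : Fin 3, ((kk jj : ℤ) :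
      ℂ) * ((X₀ : (Fin 3 → ℤ) → EuclideanSpace ℂ (Fin 3)) kk) jj) = 0) ∧ IsConjSymm (X₀ : (Fin 3 → ℤ) → EuclideanSpace
      ℂ (Fin 3))) := by
    refine ⟨hX00, fun k => by rw [hX₀]; dsimp only; rw [kdot_smul, hat k, mul_zero], fun k => ?_⟩
    rw [hX₀]
    dsimp only
    rw [freqNormSq_neg, hacs k, conjVec_smul, Complex.conj_ofReal]
  set x₀ : W := ⟨⟨X₀, memℓp_two_of_rapidDecay hX₀r⟩, (hW _).2 hX₀V⟩ with hx₀def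
  have hx₀ : ((x₀ : (lp (fun _ : Fin 3 → ℤ => EuclideanSpace ℂ (Fin 3)) 2)) : (Fin 3 → ℤ) → (EuclideanSpace ℂ (Fin
      3))) = X₀ := rfl
  have hcfX : ((fun mm : Fin 3 → ℤ => (((freqNormSq mm)⁻¹ : ℝ) : ℂ)) • (X₀ : (Fin 3 → ℤ) → EuclideanSpace ℂ (Fin 3)))
      = Function.update a 0 0 := by rw [hX₀]; exact cf_weight_smul' a
  have hcf : ((fun mm : Fin 3 → ℤ => (((freqNormSq mm)⁻¹ : ℝ) : ℂ)) • (((x₀ : (lp (fun _ : Fin 3 → ℤ => EuclideanSpace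
      ℂ (Fin 3)) 2)) : (Fin 3 → ℤ) → (EuclideanSpace ℂ (Fin 3))) : (Fin 3 → ℤ) → EuclideanSpace ℂ (Fin 3))) =
      Function.update a 0 0 := by rw [hx₀]; exact hcfX
  -- §4 the drifted steady map and its derivative
  set cν : ℝ := 4 * Real.pi ^ 2 * ν with hcν
  have hcν0 : cν ≠ 0 := by positivity
  set G : W → W := fun x => cν • x + D x + B x x with hG
  set K : W →L[ℝ] W := (hBb.deriv (x₀, x₀)).comp ((ContinuousLinearMap.id ℝ W).prod (ContinuousLinearMap.id ℝ W))
    with hK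
  have hKw : ∀ w, K w = B x₀ w + B w x₀ := fun w => by simp [hK, IsBoundedBilinearMap.deriv_apply]
  have hGd : HasStrictFDerivAt G (cν • ContinuousLinearMap.id ℝ W + (D + K)) x₀ := by
    have h := (hasStrictFDerivAt_steadyMap hBb cν x₀).add (D.hasStrictFDerivAt (x := x₀))
    have e : G = fun x => (cν • x + B x x) + D x := by
      funext x
      simp only [hG]
      abel
    rw [e]
    refine h.congr_fderiv ?_
    rw [hK]
    abel
  have hKc : IsCompactOperator K := isCompactOperator_linearised hWc hB x₀ (by rw [hcf]; exact hbr) K hKw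
  have hDKc : IsCompactOperator (D + K) := hDc.add hKc
  -- coordinates of `G`
  have hGcoe : ∀ x : W, (((G x : W) : (lp (fun _ : Fin 3 → ℤ => EuclideanSpace ℂ (Fin 3)) 2)) : (Fin 3 → ℤ) →
      (EuclideanSpace ℂ (Fin 3))) = fun k => ((cν : ℝ) : ℂ) • ((x : (lp (fun _ : Fin 3 → ℤ => EuclideanSpace ℂ (Fin
      3)) 2)) : (Fin 3 → ℤ) → (EuclideanSpace ℂ (Fin 3))) k +
      (2 * Real.pi * Complex.I * (∑ jj : Fin 3, ((k jj : ℤ) : ℂ) * (a 0) jj)) • (((fun mm : Fin 3 → ℤ => (((freqNormSq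
          mm)⁻¹ : ℝ) : ℂ)) • (((x : (lp (fun _ : Fin 3 → ℤ => EuclideanSpace ℂ (Fin 3)) 2)) : (Fin 3 → ℤ) →
          (EuclideanSpace ℂ (Fin 3))) : (Fin 3 → ℤ) → EuclideanSpace ℂ (Fin 3)))) k +
      Torus.lerayCoeff k ((WithLp.toLp 2 (fun pp : Fin 3 => transportSym (fun jj mm => (((fun mm : Fin 3 →
          ℤ => (((freqNormSq mm)⁻¹ : ℝ) : ℂ)) • (((x : (lp (fun _ : Fin 3 → ℤ => EuclideanSpace ℂ (Fin 3)) 2)) : (Fin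
          3 → ℤ) → (EuclideanSpace ℂ (Fin 3))) : (Fin 3 → ℤ) → EuclideanSpace ℂ (Fin 3)))) mm jj) (fun mm => (((fun
          mm : Fin 3 → ℤ => (((freqNormSq mm)⁻¹ : ℝ) : ℂ)) • (((x : (lp (fun _ : Fin 3 → ℤ => EuclideanSpace ℂ (Fin
          3)) 2)) : (Fin 3 → ℤ) → (EuclideanSpace ℂ (Fin 3))) : (Fin 3 → ℤ) → EuclideanSpace ℂ (Fin 3)))) mm pp) k) :
          EuclideanSpace ℂ (Fin 3))) := by
    intro x
    rw [hG]
    dsimp only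
    rw [coeW_add, coeW_add, coeW_smul, hB, hD]
    funext k
    simp only [Pi.add_apply, Pi.smul_apply, Complex.coe_smul]
  -- §5 injectivity of the linearisation (regularity + the spectral hypothesis, full family `û₀`)
  have hinj : ∀ w : W, cν • w + (D + K) w = 0 → w = 0 := by
    intro w hw0
    have hco : ∀ k : (Fin 3 → ℤ), (((4 * Real.pi ^ 2 * ν : ℝ)) : ℂ) • ((w : (lp (fun _ : Fin 3 → ℤ => EuclideanSpace ℂ
        (Fin 3)) 2)) : (Fin 3 → ℤ) → (EuclideanSpace ℂ (Fin 3))) k +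
        Torus.lerayCoeff k ((WithLp.toLp 2 (fun pp : Fin 3 => transportSym (fun jj mm => a mm jj) (fun mm => (((fun
            mm : Fin 3 → ℤ => (((freqNormSq mm)⁻¹ : ℝ) : ℂ)) • (((w : (lp (fun _ : Fin 3 → ℤ => EuclideanSpace ℂ (Fin
            3)) 2)) : (Fin 3 → ℤ) → (EuclideanSpace ℂ (Fin 3))) : (Fin 3 → ℤ) → EuclideanSpace ℂ (Fin 3)))) mm pp)
            k) : EuclideanSpace ℂ (Fin 3)) + (WithLp.toLp 2 (fun pp : Fin 3 => transportSym (fun jj mm => (((fun mm :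
            Fin 3 → ℤ => (((freqNormSq mm)⁻¹ : ℝ) : ℂ)) • (((w : (lp (fun _ : Fin 3 → ℤ => EuclideanSpace ℂ (Fin 3))
            2)) : (Fin 3 → ℤ) → (EuclideanSpace ℂ (Fin 3))) : (Fin 3 → ℤ) → EuclideanSpace ℂ (Fin 3)))) mm jj) (fun
            mm => a mm pp) k) : EuclideanSpace ℂ (Fin 3))) = 0 := by
      intro k
      have h := congrArg (fun z : W => (((z : W) : (lp (fun _ : Fin 3 → ℤ => EuclideanSpace ℂ (Fin 3)) 2)) : (Fin 3 →
          ℤ) → (EuclideanSpace ℂ (Fin 3))) k) hw0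
      dsimp only at h
      rw [coeW_add, add_apply, coeW_add, hKw, coeW_add, coeW_smul, hB, hB, hD, hcf] at h
      simp only [Pi.add_apply, Pi.smul_apply] at h
      rw [← Complex.coe_smul, Submodule.coe_zero] at h
      rw [← hcν, leray_nl_linearised_update har (w : (lp (fun _ : Fin 3 → ℤ => EuclideanSpace ℂ (Fin 3)) 2)) (W_trans
          hW w) k]
      calc _ = ((cν : ℝ) : ℂ) • ((w : (lp (fun _ : Fin 3 → ℤ => EuclideanSpace ℂ (Fin 3)) 2)) : (Fin 3 → ℤ) →
              (EuclideanSpace ℂ (Fin 3))) k +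
            ((2 * Real.pi * Complex.I * (∑ jj : Fin 3, ((k jj : ℤ) : ℂ) * (a 0) jj)) • (((fun mm : Fin 3 →
                ℤ => (((freqNormSq mm)⁻¹ : ℝ) : ℂ)) • (((w : (lp (fun _ : Fin 3 → ℤ => EuclideanSpace ℂ (Fin 3)) 2)) :
                (Fin 3 → ℤ) → (EuclideanSpace ℂ (Fin 3))) : (Fin 3 → ℤ) → EuclideanSpace ℂ (Fin 3)))) k +
              (Torus.lerayCoeff k ((WithLp.toLp 2 (fun pp : Fin 3 => transportSym (fun jj mm => (Function.update a 0
                  0) mm jj) (fun mm => (((fun mm : Fin 3 → ℤ => (((freqNormSq mm)⁻¹ : ℝ) : ℂ)) • (((w : (lp (fun _ :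
                  Fin 3 → ℤ => EuclideanSpace ℂ (Fin 3)) 2)) : (Fin 3 → ℤ) → (EuclideanSpace ℂ (Fin 3))) : (Fin 3 → ℤ)
                  → EuclideanSpace ℂ (Fin 3)))) mm pp) k) : EuclideanSpace ℂ (Fin 3))) +
                Torus.lerayCoeff k ((WithLp.toLp 2 (fun pp : Fin 3 => transportSym (fun jj mm => (((fun mm : Fin 3 →
                    ℤ => (((freqNormSq mm)⁻¹ : ℝ) : ℂ)) • (((w : (lp (fun _ : Fin 3 → ℤ => EuclideanSpace ℂ (Fin 3))
                    2)) : (Fin 3 → ℤ) → (EuclideanSpace ℂ (Fin 3))) : (Fin 3 → ℤ) → EuclideanSpace ℂ (Fin 3)))) mm jj)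
                    (fun mm => (Function.update a 0 0) mm pp) k) : EuclideanSpace ℂ (Fin 3))))) := by abel
        _ = _ := h
    have hwr : RapidDecay (((fun mm : Fin 3 → ℤ => (((freqNormSq mm)⁻¹ : ℝ) : ℂ)) • (((w : (lp (fun _ : Fin 3 →
        ℤ => EuclideanSpace ℂ (Fin 3)) 2)) : (Fin 3 → ℤ) → (EuclideanSpace ℂ (Fin 3))) : (Fin 3 → ℤ) → EuclideanSpace
        ℂ (Fin 3)))) :=
      rapidDecay_of_linearised_eq hν har hat (w : (lp (fun _ : Fin 3 → ℤ => EuclideanSpace ℂ (Fin 3)) 2)) (W_trans hW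
          w) hco
    by_contra hwne
    have hcfne : ((fun mm : Fin 3 → ℤ => (((freqNormSq mm)⁻¹ : ℝ) : ℂ)) • (((w : (lp (fun _ : Fin 3 →
        ℤ => EuclideanSpace ℂ (Fin 3)) 2)) : (Fin 3 → ℤ) → (EuclideanSpace ℂ (Fin 3))) : (Fin 3 → ℤ) → EuclideanSpace
        ℂ (Fin 3))) ≠ 0 := by
      intro hz
      apply hwne
      refine Subtype.ext (lp.ext (funext fun k => ?_))
      rw [Submodule.coe_zero]
      change ((w : (lp (fun _ : Fin 3 → ℤ => EuclideanSpace ℂ (Fin 3)) 2)) : (Fin 3 → ℤ) → (EuclideanSpace ℂ (Fin 3)))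
          k = 0
      by_cases hk : k = 0
      · subst hk; exact W_zero hW w
      · have h := congrFun hz k
        rw [cf_apply, Pi.zero_apply, smul_eq_zero] at h
        rcases h with h | h
        · exfalso
          have hf : freqNormSq k ≠ 0 := ne_of_gt (lt_of_lt_of_le one_pos (one_le_freqNormSq' hk))
          exact hf (inv_eq_zero.1 (by exact_mod_cast h))
        · exact h
    have heqc : ∀ k : (Fin 3 → ℤ), (((ν * (4 * Real.pi ^ 2 * freqNormSq k)) : ℝ) : ℂ) • (((fun mm : Fin 3 →
        ℤ => (((freqNormSq mm)⁻¹ : ℝ) : ℂ)) • (((w : (lp (fun _ : Fin 3 → ℤ => EuclideanSpace ℂ (Fin 3)) 2)) : (Fin 3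
        → ℤ) → (EuclideanSpace ℂ (Fin 3))) : (Fin 3 → ℤ) → EuclideanSpace ℂ (Fin 3)))) k +
        Torus.lerayCoeff k ((WithLp.toLp 2 (fun pp : Fin 3 => transportSym (fun jj mm => a mm jj) (fun mm => (((fun
            mm : Fin 3 → ℤ => (((freqNormSq mm)⁻¹ : ℝ) : ℂ)) • (((w : (lp (fun _ : Fin 3 → ℤ => EuclideanSpace ℂ (Fin
            3)) 2)) : (Fin 3 → ℤ) → (EuclideanSpace ℂ (Fin 3))) : (Fin 3 → ℤ) → EuclideanSpace ℂ (Fin 3)))) mm pp)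
            k) : EuclideanSpace ℂ (Fin 3)) + (WithLp.toLp 2 (fun pp : Fin 3 => transportSym (fun jj mm => (((fun mm :
            Fin 3 → ℤ => (((freqNormSq mm)⁻¹ : ℝ) : ℂ)) • (((w : (lp (fun _ : Fin 3 → ℤ => EuclideanSpace ℂ (Fin 3))
            2)) : (Fin 3 → ℤ) → (EuclideanSpace ℂ (Fin 3))) : (Fin 3 → ℤ) → EuclideanSpace ℂ (Fin 3)))) mm jj) (fun
            mm => a mm pp) k) : EuclideanSpace ℂ (Fin 3))) = 0 := fun k => by
      rw [← smul_eq_weight_smul_cf (W_zero hW w) k]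
      exact hco k
    exact hnd (isLinNSEigenvalue_of_fourier hu₀ hdiv₀ hwr (cf_transversal (W_trans hW w)) (cf_zero _) hcfne heqc)
  -- §6 the derivative is an isomorphism; local inversion
  obtain ⟨L, hL⟩ := exists_equiv_of_injective hDKc hcν0 hinj
  have hLeq : (L : W →L[ℝ] W) = cν • ContinuousLinearMap.id ℝ W + (D + K) := by
    ext w
    simp [hL w]
  have hGd' : HasStrictFDerivAt G (L : W →L[ℝ] W) x₀ := by rw [hLeq]; exact hGd
  have hGx₀ : G x₀ = y₀ := by
    refine Subtype.ext (lp.ext (funext fun k => ?_))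
    rw [hGcoe, hy₀, hF₀]
    dsimp only
    rw [hx₀, smul_eq_weight_smul_cf hX00 k, hcfX, ← heq₀ k, leray_nl_self_update har hat k, weight_smul_update]
    abel
  -- radii: a `W`-radius `r` of the local inversion, the `L²`-radius `r²`
  set δ' : ℝ := min 1 (δ / (2 * (1 + 4 * Real.pi ^ 2))) with hδ'
  have hδ'0 : 0 < δ' := lt_min one_pos (by positivity)
  have hδ'1 : δ' ≤ 1 := min_le_left _ _
  have hδ'2 : δ' ≤ δ / (2 * (1 + 4 * Real.pi ^ 2)) := min_le_right _ _
  obtain ⟨r, hr, hsolve⟩ := local_solve hGd' hδ'0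
  refine ⟨r ^ 2, by positivity, fun g hg hgd hg0 hgf => ?_⟩
  -- the target `ĝ ∈ W` of the admissible force `g` (`Π ĝ = ĝ`), with `‖ĝ − Π f̂‖_W ≤ ‖g − f‖_{L²} < r` (Parseval)
  have hYV : ((mFourierCoeff (complexify ∘ g) : (Fin 3 → ℤ) → EuclideanSpace ℂ (Fin 3)) 0 = 0 ∧ (∀ kk : Fin 3 → ℤ,
      (∑ jj : Fin 3, ((kk jj : ℤ) : ℂ) * ((mFourierCoeff (complexify ∘ g) : (Fin 3 → ℤ) → EuclideanSpace ℂ (Fin 3)) kk)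
      jj) = 0) ∧ IsConjSymm (mFourierCoeff (complexify ∘ g) : (Fin 3 → ℤ) → EuclideanSpace ℂ (Fin 3))) :=
    ⟨mFourierCoeff_complexify_zero_of_hasZeroMean hg hg0, fun k => hgd.sum_mul_mFourierCoeff_eq_zero hg k,
      isConjSymm_mFourierCoeff hg.integrable⟩
  set y : W := ⟨⟨mFourierCoeff (complexify ∘ g), memℓp_two_of_rapidDecay hg.complexify_comp.rapidDecay_mFourierCoeff⟩,
    (hW _).2 hYV⟩ with hydef
  have hy : ((y : (lp (fun _ : Fin 3 → ℤ => EuclideanSpace ℂ (Fin 3)) 2)) : (Fin 3 → ℤ) → (EuclideanSpace ℂ (Fin 3)))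
      = mFourierCoeff (complexify ∘ g) := rfl
  have hPg : ∀ k : (Fin 3 → ℤ), Torus.lerayCoeff k (mFourierCoeff (complexify ∘ g) k) = mFourierCoeff (complexify ∘ g)
      k := fun k => by
    by_cases hk : k = 0
    · rw [hk, hYV.1]; exact Torus.lerayCoeff_zero _
    · exact lerayCoeff_of_kdot_eq_zero hk (hYV.2.1 k)
  have hpar := tsum_enorm_sq_mFourierCoeff_euclidean ((hg.sub hf).complexify_comp).continuous
  have hn : ∀ x, ‖(complexify ∘ (g - f)) x‖ = ‖g x - f x‖ := fun x => by
    rw [Function.comp_apply, Pi.sub_apply, norm_complexify]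
  simp_rw [hn] at hpar
  obtain ⟨x, hGx, hdist⟩ := hsolve y (by
    rw [hGx₀, dist_eq_norm, ← norm_coeW]
    refine lt_of_le_of_lt (l2_norm_le_of_tsum_le ((y - y₀ : W) : (lp (fun _ : Fin 3 → ℤ => EuclideanSpace ℂ (Fin 3))
      2)) (Real.sqrt_nonneg _) ?_) ((Real.sqrt_lt' hr).2 hgf)
    rw [← ENNReal.ofReal_pow (Real.sqrt_nonneg _), Real.sq_sqrt (integral_nonneg fun _ => sq_nonneg _), ← hpar]
    refine ENNReal.tsum_le_tsum fun k => ?_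
    rw [coeW_sub, Pi.sub_apply, hy, hy₀, hF₀]
    dsimp only
    rw [← hPg k, ← lerayCoeff_sub', complexify_comp_sub,
      mFourierCoeff_sub hg.complexify_comp.integrable hf.complexify_comp.integrable]
    exact ENNReal.pow_le_pow_left (enorm_lerayCoeff_le k _))
  -- §7 the perturbed solution is a classical steady state with the same mean
  have hxeq : ∀ k : (Fin 3 → ℤ), (((cν : ℝ)) : ℂ) • ((x : (lp (fun _ : Fin 3 → ℤ => EuclideanSpace ℂ (Fin 3)) 2)) :
      (Fin 3 → ℤ) → (EuclideanSpace ℂ (Fin 3))) k +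
      (2 * Real.pi * Complex.I * (∑ jj : Fin 3, ((k jj : ℤ) : ℂ) * (a 0) jj)) • (((fun mm : Fin 3 → ℤ => (((freqNormSq
          mm)⁻¹ : ℝ) : ℂ)) • (((x : (lp (fun _ : Fin 3 → ℤ => EuclideanSpace ℂ (Fin 3)) 2)) : (Fin 3 → ℤ) →
          (EuclideanSpace ℂ (Fin 3))) : (Fin 3 → ℤ) → EuclideanSpace ℂ (Fin 3)))) k +
      Torus.lerayCoeff k ((WithLp.toLp 2 (fun pp : Fin 3 => transportSym (fun jj mm => (((fun mm : Fin 3 →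
          ℤ => (((freqNormSq mm)⁻¹ : ℝ) : ℂ)) • (((x : (lp (fun _ : Fin 3 → ℤ => EuclideanSpace ℂ (Fin 3)) 2)) : (Fin
          3 → ℤ) → (EuclideanSpace ℂ (Fin 3))) : (Fin 3 → ℤ) → EuclideanSpace ℂ (Fin 3)))) mm jj) (fun mm => (((fun
          mm : Fin 3 → ℤ => (((freqNormSq mm)⁻¹ : ℝ) : ℂ)) • (((x : (lp (fun _ : Fin 3 → ℤ => EuclideanSpace ℂ (Fin
          3)) 2)) : (Fin 3 → ℤ) → (EuclideanSpace ℂ (Fin 3))) : (Fin 3 → ℤ) → EuclideanSpace ℂ (Fin 3)))) mm pp) k) :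
          EuclideanSpace ℂ (Fin 3))) =
      mFourierCoeff (complexify ∘ g) k := by
    intro k
    have h := congrArg (fun z : W => (((z : W) : (lp (fun _ : Fin 3 → ℤ => EuclideanSpace ℂ (Fin 3)) 2)) : (Fin 3 → ℤ)
        → (EuclideanSpace ℂ (Fin 3))) k) hGx
    dsimp only at h
    rw [hGcoe, hy] at h
    exact h
  have hxr : RapidDecay (((fun mm : Fin 3 → ℤ => (((freqNormSq mm)⁻¹ : ℝ) : ℂ)) • (((x : (lp (fun _ : Fin 3 →
      ℤ => EuclideanSpace ℂ (Fin 3)) 2)) : (Fin 3 → ℤ) → (EuclideanSpace ℂ (Fin 3))) : (Fin 3 → ℤ) → EuclideanSpace ℂ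
      (Fin 3)))) :=
    rapidDecay_of_perturbed_eq hν (rapidDecay_single (a 0)) (single_transversal (a 0)) (x : (lp (fun _ : Fin 3 →
        ℤ => EuclideanSpace ℂ (Fin 3)) 2)) (W_trans hW x)
      (fun s => tsum_weight_mul_enorm_ne_top_of_rapidDecay hg.complexify_comp.rapidDecay_mFourierCoeff s)
      (fun k => by
        rw [leray_nl_linearised_single (a 0) (W_trans hW x) k, ← hcν]
        exact hxeq k)
  -- the full family of the perturbed state: zero mode restored
  set c₁ : (Fin 3 → ℤ) → (EuclideanSpace ℂ (Fin 3)) := ((fun mm : Fin 3 → ℤ => (((freqNormSq mm)⁻¹ : ℝ) : ℂ)) • (((x :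
      (lp (fun _ : Fin 3 → ℤ => EuclideanSpace ℂ (Fin 3)) 2)) : (Fin 3 → ℤ) → (EuclideanSpace ℂ (Fin 3))) : (Fin 3 →
      ℤ) → EuclideanSpace ℂ (Fin 3))) + (Pi.single (0 : (Fin 3 → ℤ)) (a 0) : (Fin 3 → ℤ) → (EuclideanSpace ℂ (Fin
      3))) with hc₁
  have hc₁r : RapidDecay c₁ := hxr.add (rapidDecay_single _)
  have hc₁cs : IsConjSymm c₁ := (isConjSymm_cf (W_conj hW x)).add (isConjSymm_single hM)
  have hc₁t : ∀ k : (Fin 3 → ℤ), (∑ jj : Fin 3, ((k jj : ℤ) : ℂ) * (c₁ k) jj) = 0 := fun k => by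
    rw [hc₁, Pi.add_apply, kdot_add, cf_transversal (W_trans hW x) k, single_transversal, add_zero]
  have hupd : Function.update c₁ 0 0 = ((fun mm : Fin 3 → ℤ => (((freqNormSq mm)⁻¹ : ℝ) : ℂ)) • (((x : (lp (fun _ :
      Fin 3 → ℤ => EuclideanSpace ℂ (Fin 3)) 2)) : (Fin 3 → ℤ) → (EuclideanSpace ℂ (Fin 3))) : (Fin 3 → ℤ) →
      EuclideanSpace ℂ (Fin 3))) := update_add_single_of_zero (cf_zero _) _
  have hc₁0 : c₁ 0 = a 0 := add_single_apply_zero (cf_zero _) _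
  have heq₁ : ∀ k : (Fin 3 → ℤ), (((ν * (4 * Real.pi ^ 2 * freqNormSq k)) : ℝ) : ℂ) • c₁ k + Torus.lerayCoeff k
      ((WithLp.toLp 2 (fun pp : Fin 3 => transportSym (fun jj mm => c₁ mm jj) (fun mm => c₁ mm pp) k) : EuclideanSpace
      ℂ (Fin 3))) =
      mFourierCoeff (complexify ∘ g) k := by
    intro k
    rw [leray_nl_self_update hc₁r hc₁t k, ← weight_smul_update c₁ k, hupd, hc₁0, ← hxeq k,
      smul_eq_weight_smul_cf (W_zero hW x) k]
    abel
  obtain ⟨u', p', hst', hu', hû'⟩ := steadyState_of_fourier' hg hgd hg0 hc₁r hc₁cs hc₁t heq₁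
  refine ⟨u', p', hst', integral_eq_of_mFourierCoeff_zero_eq hu' hu₀ (by rw [hû', hc₁0]), ?_⟩
  -- §8 the `H¹` estimate
  set z : W := x - x₀ with hz
  have hzn : ‖z‖ < δ' := by rwa [hz, ← dist_eq_norm]
  have hv : IsSmooth (fun y => u' y - u₀ y) := hu'.sub hu₀
  have hcoefv : mFourierCoeff (complexify ∘ fun y => u' y - u₀ y) = ((fun mm : Fin 3 → ℤ => (((freqNormSq mm)⁻¹ : ℝ) :
      ℂ)) • ((((z : W) : (lp (fun _ : Fin 3 → ℤ => EuclideanSpace ℂ (Fin 3)) 2)) : (Fin 3 → ℤ) → (EuclideanSpace ℂ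
      (Fin 3))) : (Fin 3 → ℤ) → EuclideanSpace ℂ (Fin 3))) := by
    have e : (complexify ∘ fun y => u' y - u₀ y : (UnitAddTorus (Fin 3)) → (EuclideanSpace ℂ (Fin 3))) = (complexify
        ∘ u') - (complexify ∘ u₀) := by
      funext y; simp
    rw [e, hz, coeW_sub]
    funext k
    rw [mFourierCoeff_sub hu'.complexify_comp.integrable hu₀.complexify_comp.integrable, hû', ← ha]
    have hak : a k = Function.update a 0 0 k + (Pi.single (0 : (Fin 3 → ℤ)) (a 0) : (Fin 3 → ℤ) → (EuclideanSpace ℂ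
        (Fin 3))) k :=
      (congrFun (update_add_single a) k).symm
    rw [hak, ← hcf, hc₁]
    simp only [Pi.add_apply, Pi.smul_apply', Pi.sub_apply, smul_sub]
    abel
  have hH := h1_le_of_coeff hv (z : (lp (fun _ : Fin 3 → ℤ => EuclideanSpace ℂ (Fin 3)) 2)) hcoefv
  rw [norm_coeW] at hH
  change (∫ y, ‖u' y - u₀ y‖ ^ 2) + gradNormSq (fun y => u' y - u₀ y) < δ
  have hpi : (0 : ℝ) < 1 + 4 * Real.pi ^ 2 := by positivity
  have hz2 : ‖z‖ ^ 2 ≤ δ' * δ' := by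
    have := norm_nonneg z
    nlinarith
  have hd : δ' * δ' ≤ δ' := by nlinarith
  calc (∫ y, ‖u' y - u₀ y‖ ^ 2) + gradNormSq (fun y => u' y - u₀ y) ≤ (1 + 4 * Real.pi ^ 2) * ‖z‖ ^ 2 := hH
    _ ≤ (1 + 4 * Real.pi ^ 2) * δ' := by nlinarith
    _ ≤ (1 + 4 * Real.pi ^ 2) * (δ / (2 * (1 + 4 * Real.pi ^ 2))) := mul_le_mul_of_nonneg_left hδ'2 hpi.le
    _ = δ / 2 := by field_simp
    _ < δ := by linarith

end Summit.AnomalousDissipation.AnomalousDissipation.Theorems.RobustLoudUpgrade.Poly.PersistSmoothForce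

end
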